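import Summits.HubbardSuperconductivity.HubbardSuperconductivity.Theorems.AnisotropyChordTransferFibre3N1Row
import Summits.HubbardSuperconductivity.HubbardSuperconductivity.Theorems.AnisotropyChordTransferFibre3Level2RowA
import Summits.HubbardSuperconductivity.HubbardSuperconductivity.Theorems.AnisotropyChordTransferFibre3ManifoldA
import Summits.HubbardSuperconductivity.HubbardSuperconductivity.Theorems.AnisotropyChordTransferFibre3ClosedExpansions
import Summits.HubbardSuperconductivity.HubbardSuperconductivity.Theorems.AnisotropyChordTransferFibre3PhiHatClosed
import Summits.HubbardSuperconductivity.HubbardSuperconductivity.Theorems.AnisotropyChordTransferFibre3G2OneLoop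
import Summits.HubbardSuperconductivity.HubbardSuperconductivity.Theorems.AnisotropyChordTransferFibre3MuClosed
import Summits.HubbardSuperconductivity.HubbardSuperconductivity.Theorems.AnisotropyChordTransferFibre3OneLoopCross

/-!
# Route `AnisotropyChord` / H0 rotor rung: PORT PartN41-F — `N1RowJUFactor`, the SYMBOLIC ν-FACTORISATION of the `N₁` row
(the `Δ → 1` / `ν → 0` corner of the per-`L` and `∀ L ≥ 128` certificates; ruling R3)

Port (verbatim modulo this header) of the theory seat's file `hubbard-h0-rotor-theory-1/cycle23/lean/PartN41F.lean`
(sha16 `3f6ed68bc89a1b85`; theory seat `hubbard-h0-rotor-theory-1` g23, RESULT 2 2026-08-30T11:58Z; memo ROTOR-THEORY-23 §350).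
STATEMENTS + PROOFS: every `def … : Prop` of the file has its `…_holds` in §6 (theory's own proofs, rc 0, no sorry; nothing added
or removed here).  Consumers: p2/p3 evaluators (the reduced row `N1red/Ured`, `TrialGapFromReduced`) for the corner `Δ > .98` /
`ν < 3.16e-4`.  Ported by prover seat `hubbard-h0-rotor-p1` g29 (route lead); `--supports stmt-HubbardSuperconductivity-23918`.
WHAT THIS IS NOT: nothing here proves superconductivity in the Hubbard model.

ORIGINAL MODULE DOCSTRING (theory-1 g23):

# PartN41-F — `N1RowJUFactor`: the SYMBOLIC ν-FACTORISATION of the `N₁` row (the `Δ → 1` corner of the per-`L` and of the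
`∀ L ≥ 128` certificates; theory-1 g23, memo 23 §350; lead REPORT 4 ruling R3(i), p2 g5 FINAL ask, p3 FINDING 2(c))

STATEMENTS + PROOFS (`def … : Prop` = named target, EVERY ONE PROVED in §6 of this file — `…_holds`, no sorry, no axiom,
`lean check` rc 0, audit: 10/10 Props kernel-closed; plain `def` = object).  Independently every identity is VERIFIED to rounding
on exact torus objects, cycle23/calc/check_partN41F{,_v2}.{py,out}: L = 9 … 128, Δ = .9 … 1 − 10⁻⁵, relative errors 1e-16 … 1e-8.

THE PROBLEM (lead Q1, p3 FINDING 2(c)).  In `N₁ = −ε₁(B + 6Δf_nn²A) − (Q/P)(B + ε₁P/2) − (3/2)ε₁λ₂P + B_C` (`N1Identity` +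
`G2OneLoopForm` + `TplusFromPC0`, all landed) the two pieces `−ε₁B` and `−6ε₁Δf_nn²A` are EACH of size `≈ 12π²a²·(…)` while their
sum, and `U = 3V²T⁺ = 9V²λ₂(1 + o(1))`, are `O(ν)`: measured `−ε₁B/U = +23.4, −6ε₁Δf²A/U = −22.8` at `(L, Δ) = (12, .999)`
(`ν = 1.0e-4`), `+2.9/−2.2` at `(12, .99)`, `+6.4/−5.7` at `(24, .999)` (cycle23/calc/n1_ju_anatomy.out).  An interval evaluator of
relative width `w` therefore loses `≈ 37·w·c₁` at `ν = 1e-4` (`∝ w/ν`): p3's `c₁LB(L=9) = .48/.36/.155/−.37` at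
`ν = .002/.001/5e-4/2e-4` against the true `c₁(9, ν→0) = .604`.  No cell refinement cures this; the `ν` must come out SYMBOLICALLY.

THE FACTORISATION (this file).  On the solution manifold (`ManifoldDictionary`, landed as `ManifoldA.manifold_dictionary`):
`η_eff = Vλ₂/4 = f_nn − a`, `c_s = λ₂(V + a)`, `σ := 1 − a + a/V = c_s G̃(0) = λ₂(V+a)G̃(0)`, `Δf_nn² = a² + λ₂·aV/4`
(`a := Δf_nn`, `V = L²`).  The profile is `f = (1 − δ₀)(1 + a/V − c_s G̃)`, i.e. `s := 1 − f = c_s G̃ − a/V` at EVERY site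
(including `0`: `s(0) = 1 − a = σ − a/V`).  Hence, with `b := 1 + a/V`, `j(k) := b²V δ_{k0} − a²`, `z := e^{−ik·e}`:

  (F)  `F₂(k) = j(k) + λ₂·FSr(k)` for ALL `k`,  `FSr(k) = −2b(V+a)·g(k) + λ₂(V+a)²·T₂(k)`,  `T₂ := FT[G̃²] = (1/V)Σ_p g(p)g(k−p)`;
  (Φ)  `φ̂_e(k) = a²·z + λ₂·φSr_e(k)`,  `φSr_e(k) = (aV/4)(1 + z) − b(V+a)(1 − z)g(k) + ½λ₂(V+a)²[(1 − z)T₂(k) + T_e(k)]` (`k ≠ 0`),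
       `T_e := FT[(D_e G̃)²]` (complex; `τ_e = c_s²T_e`, `t = c_s²T₂ − (2a/V)c_s g` off `0`), and `φSr_e(0) = aV/4 + F₂(0)/4`;
  (JU) the pure-`j`/pure-`a²z` ("jump") parts of the five one-loop objects are CLOSED polynomials `P_JU, A_JU, B_JU` in `(a, b, V)`
       and the three combinations that enter `N₁`, `T⁺` carry the manifold factor `σ = λ₂(V+a)G̃(0)`:
       `B_JU + 6a²A_JU = 6a⁴σ(a+b)`, `Q_JU = −6a⁴σ(a+b)`, `BC_JU = −12a⁴σ(a+b)(2 + cos θ)`;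
  (S)  every other monomial of `P, A, B, Q, B_C` contains ≥ 1 reduced slot `FSr`/`φSr` and an explicit power of `λ₂`:
       `X = X_JU + λ₂·XSr`, `XSr = X⁽¹⁾ + λ₂X⁽²⁾ + λ₂²X⁽³⁾` (graded by the number of reduced slots; §3);
  (★)  `N₁ = λ₂ · N1red`, `U = λ₂ · Ured`, `T⁺ = λ₂·(3 + (Q_JU/λ₂ + QSr)/P)` with `N1red`, `Ured` EXPLICIT in the reduced objects
       (§4) — NO CANCELLATION IS LEFT: `c₁ = N1red/Ured` is a ratio of `O(1)`-conditioned quantities, and an evaluator of relative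
       width `w` now loses `O(w)`, uniformly in `ν ∈ (0, ν₁]`.

MEASURED STRUCTURE of `N1red` (units of `Ured`; cycle23/calc/check_partN41F{,_v2}.out; columns `−ε₁B⁽¹⁾`, `BC⁽¹⁾`, the jump
column `(N₁)_JU/λ₂ = N1JUlin + BCJUr − Q_JU(…)/λ₂ ≈ BCJUr ≈ −8G̃(0)/V`, `−(3/2)ε₁aV·A`, `−(3/2)ε₁P`, rest):
  `L =   9, ν → 0⁺ : +.688  +.039  −.040  −.040  −.040  |rest| ≤ .002   ⇒ c₁(9, 0⁺)  = .6039` (`.6004` at Δ = .98)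
  `L =  12, ν → 0⁺ : +.678  +.025  −.025  −.023  −.023                 ⇒ c₁(12, 0⁺) = .6308` (`.6127` at Δ = .9, `.6288` at .99)
  `L =  24, ν → 0⁺ : +.669  +.008  −.008  −.006  −.006                 ⇒ c₁(24, 0⁺) = .6577`
  `L =  32/48/64   :                                                      c₁ = .6614/.6643/.6655` (Δ = .9976 and ν → 0⁺ agree to 5e-4)
  `L = 128, Δ=.9976 (ν = 2.4e-4, THE strip corner): +.6666 +.0004 −.0004 −.0002 −.0002 ⇒ c₁ = .6657`; Δ = .999: `.6661`.
The leading class is ONE momentum, the `k = K₁` term of `B⁽¹⁾`: `−ε₁·(6/V)·j(0)²·FSr(K₁) = 12·ε₁g(K₁)·b(V+a)·j(0)²/V + O(λ₂)`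
`≈ 6V²·(2ε₁g(K₁))`, so `c₁ → (4/3)·ε₁ g(K₁) = (2/3)·2ε₁/(2ε₁ − λ₂) → 2/3` as `ν → 0`, `L → ∞` — the SU(2) corner of the `N₁`
row is the explicit number `2/3`, approached from below, and `c₁(L, ν) ≥ .60` on the whole corner `L ≥ 9`, `ν ≤ 2e-3`
(measured; vs the c of record ≤ .51).
The `λ₂`-suppressed classes (`λ₂B⁽²⁾, λ₂²B⁽³⁾, λ₂Q⁽²⁾, …`) are ≤ 1.2e-2 at ν = .01, ≤ 1.3e-3 at ν = .001, ≤ 3e-4 on the strip: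
at the corner the row is ONE-SLOT LINEAR in the reduced tails, which the existing named-sum brackets (`B1.b1Bracket`,
`TtailBounds` ↦ `T₂ ≤ 2G̃(0)/(ε(k) − 2λ₂)`, `TauTailBound` ↦ `|T_e| ≤ T_e(0) = ‖D_eG̃‖²`) already control with RELATIVE width.

HOW THE EVALUATORS USE IT (port notes at the end): replace the objects `(B, A, P, Q, B_C)` by `(B_JU + λ₂BSr, …)` with the JU
parts in closed form and `σ` substituted SYMBOLICALLY (`σ = λ₂(V+a)G̃(0)`, never `1 − a + a/V` from the `a`-interval), divide the
assembled `N₁` and `U` by `λ₂` symbolically (§4 gives the quotient), and certify `c·Ured ≤ N1red` (`TrialGapFromReduced`).  For the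
per-`L` certificates this closes `Δ ∈ (Δ₁, 1)` at every `L ≥ 9` with one cell in `ν` (the reduced row is Lipschitz in `ν` with an
`O(1)` constant); for `∀ L ≥ 128` it closes the strip corner / p2's R3 (`G̃(0)` enters only `N1JUlin`, `QJUr`, `BCJUr`, through
`(V+a)G̃(0)·a⁴(a+b)/Ured = O(G̃(0)/V) ≤ 4.1e-4` at `L ≥ 128` by `capacity_KT_bounds`, a constant, no `ln L` in the box).
-/

set_option linter.dupNamespace false
set_option autoImplicit false

noncomputable section

open scoped BigOperators
open Complex Finset

namespace Summit.HubbardSuperconductivity.HubbardSuperconductivity.Theorems.AnisotropyChord.Transfer.Fibre3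

namespace N41F

variable (L : ℕ) [NeZero L]

/-! ## §1 Reduced scalars and the reduced profile objects (`j`, `FSr`, `φSr`, `T₂`, `T_e`) -/

/-- `b := 1 + a/V` (`a = aPar = Δ f(x̂)`). -/
def bPar (Δ : ℝ) (f : Tor L → ℝ) : ℝ := 1 + aPar L Δ f / (L : ℝ) ^ 2

/-- `σ := 1 − a + a/V` (`= c_s G̃(0) = λ₂(V+a)G̃(0)` on the manifold: `cS_mul_Gres_zero`; `= b − a`). -/
def sigPar (Δ : ℝ) (f : Tor L → ℝ) : ℝ := 1 - aPar L Δ f + aPar L Δ f / (L : ℝ) ^ 2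

/-- the JUMP part of `F₂`: `j(k) := b²V·δ_{k,0} − a²`. -/
def jK (Δ : ℝ) (f : Tor L → ℝ) (k : Tor L) : ℝ :=
  (if k = 0 then bPar L Δ f ^ 2 * (L : ℝ) ^ 2 else 0) - aPar L Δ f ^ 2

/-- the two-propagator convolution `T₂(k) := FT[G̃²](k) = (1/V) Σ_p g(p) g(k − p)` (real: `G̃` is even). -/
def T2fun (lam2 : ℝ) (k : Tor L) : ℝ := (dft L (fun r => Gres L lam2 r ^ 2) k).re

/-- the gradient two-propagator sum `T_e(k) := FT[(D_e G̃)²](k)` (COMPLEX; `τ_e = c_s² T_e`, cf. `tauC`). -/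
def TeC (lam2 : ℝ) (e k : Tor L) : ℂ := dft L (fun r => Dgrad L (Gres L lam2) e r ^ 2) k

/-- the REDUCED smooth part of `F₂`: `FSr(k) := −2b(V+a)·g(k) + λ₂(V+a)²·T₂(k)` (so that `F₂ = j + λ₂·FSr`, `F2NuSplit`). -/
def FSr (Δ lam2 : ℝ) (f : Tor L → ℝ) (k : Tor L) : ℝ :=
  -2 * bPar L Δ f * ((L : ℝ) ^ 2 + aPar L Δ f) * gres L lam2 k
    + lam2 * ((L : ℝ) ^ 2 + aPar L Δ f) ^ 2 * T2fun L lam2 k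

/-- the REDUCED smooth part of `φ̂_e`: `φSr_e(0) := aV/4 + F₂(0)/4` and, for `k ≠ 0`,
`φSr_e(k) := (aV/4)(1 + z) − b(V+a)(1 − z)g(k) + ½λ₂(V+a)²[(1 − z)T₂(k) + T_e(k)]`, `z = e^{−ik·e}` (`PhiHatNuSplit`). -/
def phiSr (Δ lam2 : ℝ) (f : Tor L → ℝ) (e k : Tor L) : ℂ :=
  if k = 0 then ((aPar L Δ f * (L : ℝ) ^ 2 / 4 + nf2V L Δ f / 4 : ℝ) : ℂ)
  else ((aPar L Δ f * (L : ℝ) ^ 2 / 4 : ℝ) : ℂ) * (1 + zPh L k e)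
        - ((bPar L Δ f * ((L : ℝ) ^ 2 + aPar L Δ f) * gres L lam2 k : ℝ) : ℂ) * (1 - zPh L k e)
        + ((lam2 * ((L : ℝ) ^ 2 + aPar L Δ f) ^ 2 / 2 : ℝ) : ℂ) * ((1 - zPh L k e) * ((T2fun L lam2 k : ℝ) : ℂ) + TeC L lam2 e k)

/-- ★ THE ν-DICTIONARY (all from `ManifoldDictionary` (i)(ii)(iii)(v), landed): `f(x̂) − a = Vλ₂/4`, `c_s = λ₂(V + a)`,
`σ = λ₂(V+a)G̃(0)`, `Δ f(x̂)² = a² + λ₂·aV/4`, and `b − a = σ`. -/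
def DictionaryNu (Δ : ℝ) : Prop :=
  ∀ lam2 : ℝ, ∀ f : Tor L → ℝ, 5 ≤ L → 0 ≤ Δ → Δ < 1 → IsGroundTwoMagnon L Δ lam2 f →
    f (K1 L) - aPar L Δ f = (L : ℝ) ^ 2 * lam2 / 4 ∧
    cS L Δ lam2 f = lam2 * ((L : ℝ) ^ 2 + aPar L Δ f) ∧
    sigPar L Δ f = lam2 * ((L : ℝ) ^ 2 + aPar L Δ f) * Gres L lam2 0 ∧
    Δ * f (K1 L) ^ 2 = aPar L Δ f ^ 2 + lam2 * (aPar L Δ f * (L : ℝ) ^ 2 / 4) ∧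
    bPar L Δ f - aPar L Δ f = sigPar L Δ f

/-- ★ THE PROFILE IS SMOOTH PLUS A CONSTANT AT EVERY SITE: `s(r) = c_s G̃(r) − a/V` for ALL `r` (`r ≠ 0`: `ground_profile_aKer`
+ (v); `r = 0`: `s(0) = 1 − a = σ − a/V`).  Hence the tails are Green two-propagator sums times explicit powers of `c_s`:
`t(k) = c_s² T₂(k) − (2a/V)c_s g(k)` (`k ≠ 0`), `‖s‖² = t(0) = c_s² T₂(0) + a²/V`, `τ_e(k) = c_s² T_e(k)`. -/
def TailsViaGreen (Δ : ℝ) : Prop :=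
  ∀ lam2 : ℝ, ∀ f : Tor L → ℝ, 5 ≤ L → 0 ≤ Δ → Δ < 1 → IsGroundTwoMagnon L Δ lam2 f →
    (∀ r : Tor L, sfun' L Δ f r = cS L Δ lam2 f * Gres L lam2 r - aPar L Δ f / (L : ℝ) ^ 2) ∧
    (∀ k : Tor L, k ≠ 0 →
      tfun L Δ f k = cS L Δ lam2 f ^ 2 * T2fun L lam2 k - 2 * aPar L Δ f / (L : ℝ) ^ 2 * cS L Δ lam2 f * gres L lam2 k) ∧
    sNormSq L Δ f = cS L Δ lam2 f ^ 2 * T2fun L lam2 0 + aPar L Δ f ^ 2 / (L : ℝ) ^ 2 ∧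
    (∀ e ∈ nnList L, ∀ k : Tor L, tauC L Δ f e k = ((cS L Δ lam2 f ^ 2 : ℝ) : ℂ) * TeC L lam2 e k)

/-- ★ (F) `F₂(k) = j(k) + λ₂·FSr(k)` for EVERY `k` (`F2ClosedPlusTail` + `TailsViaGreen` + `DictionaryNu`; at `k = 0`:
`F₂(0) = V + 2a − a² + ‖s‖² = b²V − a² + λ₂·[λ₂(V+a)²T₂(0)]`). -/
def F2NuSplit (Δ : ℝ) : Prop :=
  ∀ lam2 : ℝ, ∀ f : Tor L → ℝ, 5 ≤ L → 0 ≤ Δ → Δ < 1 → IsGroundTwoMagnon L Δ lam2 f →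
    ∀ k : Tor L, F2 L f k = jK L Δ f k + lam2 * FSr L Δ lam2 f k

/-- ★ (Φ) `φ̂_e(k) = a²·e^{−ik·e} + λ₂·φSr_e(k)` for EVERY `k` and `e` a nearest neighbour (`PhiHatClosedPlusTail` + `TailsViaGreen`
+ `DictionaryNu`: `μ_e = a²z + aη(1 + z) − (1 − z)c_s g`, `aη = λ₂·aV/4`, `½(1−z)t = ½(1−z)c_s²T₂ − (a/V)(1−z)c_s g`,
`(1 + a/V)c_s = λ₂ b(V+a)`; at `k = 0`: `γ = a² + λ₂(F₂(0) + aV)/4`). -/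
def PhiHatNuSplit (Δ : ℝ) : Prop :=
  ∀ lam2 : ℝ, ∀ f : Tor L → ℝ, 5 ≤ L → 0 ≤ Δ → Δ < 1 → IsGroundTwoMagnon L Δ lam2 f →
    ∀ e ∈ nnList L, ∀ k : Tor L,
      phiHat L f e k = ((aPar L Δ f ^ 2 : ℝ) : ℂ) * zPh L k e + (lam2 : ℂ) * phiSr L Δ lam2 f e k

/-- PARSEVAL CLOSURES of the reduced slot (exact; `Σ_k F₂ = V f(0)² = 0`, `Σ_k F₂ cos kₓ = V f(x̂)²`, `s̃(x̂) := c_sG̃(x̂) = b − f(x̂)`):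
`Σ_k FSr(k) = −V(V+a)G̃(0)(a + b)` and `Σ_k FSr(k) cos kₓ = −V(V+a)G̃(x̂)(f(x̂) + b)`. -/
def FSrClosures (Δ : ℝ) : Prop :=
  ∀ lam2 : ℝ, ∀ f : Tor L → ℝ, 5 ≤ L → 0 ≤ Δ → Δ < 1 → IsGroundTwoMagnon L Δ lam2 f →
    (∑ k : Tor L, FSr L Δ lam2 f k)
        = -(L : ℝ) ^ 2 * ((L : ℝ) ^ 2 + aPar L Δ f) * Gres L lam2 0 * (aPar L Δ f + bPar L Δ f) ∧
    (∑ k : Tor L, FSr L Δ lam2 f k * Real.cos (2 * Real.pi * k.1.val / L))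
        = -(L : ℝ) ^ 2 * ((L : ℝ) ^ 2 + aPar L Δ f) * Gres L lam2 (K1 L) * (f (K1 L) + bPar L Δ f)

/-! ## §2 The jump parts in closed form and the σ-factor -/

/-- `j(0) = b²V − a²`. -/
def Jb (Δ : ℝ) (f : Tor L → ℝ) : ℝ := bPar L Δ f ^ 2 * (L : ℝ) ^ 2 - aPar L Δ f ^ 2

/-- `P_JU := (1/V)Σ_k j³ = (j(0)³ − (V − 1)a⁶)/V`. -/
def PJU (Δ : ℝ) (f : Tor L → ℝ) : ℝ := (Jb L Δ f ^ 3 - ((L : ℝ) ^ 2 - 1) * aPar L Δ f ^ 6) / (L : ℝ) ^ 2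

/-- `A_JU := (1/V)Σ_k j² cos kₓ = (j(0)² − a⁴)/V`. -/
def AJU (Δ : ℝ) (f : Tor L → ℝ) : ℝ := (Jb L Δ f ^ 2 - aPar L Δ f ^ 4) / (L : ℝ) ^ 2

/-- `B_JU := (6/V)Σ_k j(k)² j(k + K₁) = (6/V)(−a² j(0)² + a⁴ j(0) − (V − 2)a⁶)`. -/
def BJU (Δ : ℝ) (f : Tor L → ℝ) : ℝ :=
  6 * (-(aPar L Δ f ^ 2) * Jb L Δ f ^ 2 + aPar L Δ f ^ 4 * Jb L Δ f - ((L : ℝ) ^ 2 - 2) * aPar L Δ f ^ 6) / (L : ℝ) ^ 2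

/-- `Q_JU/λ₂ := −6a⁴(a + b)(V + a)G̃(0)` (`Q_JU = −(3/2)·4·a⁴·(1/V)Σ_k j = −6a⁴(b² − a²) = −6a⁴σ(a+b)`, `σ = λ₂(V+a)G̃(0)`). -/
def QJUr (Δ lam2 : ℝ) (f : Tor L → ℝ) : ℝ :=
  -6 * aPar L Δ f ^ 4 * (aPar L Δ f + bPar L Δ f) * ((L : ℝ) ^ 2 + aPar L Δ f) * Gres L lam2 0

/-- `BC_JU/λ₂ := −12a⁴(a + b)(V + a)G̃(0)(2 + cos θ)`. -/
def BCJUr (Δ lam2 : ℝ) (f : Tor L → ℝ) : ℝ :=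
  -12 * aPar L Δ f ^ 4 * (aPar L Δ f + bPar L Δ f) * ((L : ℝ) ^ 2 + aPar L Δ f) * Gres L lam2 0
    * (2 + Real.cos (2 * Real.pi / L))

/-- ★ (JU) THE JUMP SUMS IN CLOSED FORM (pure finite trigonometric sums: `Σ_{k} cos kₓ = 0`, `#Tor = V`; no hypothesis on `f`
beyond `L ≥ 3`) and the σ-FACTOR of the three combinations entering `N₁`, `T⁺`. -/
def JUClosedSums (Δ : ℝ) : Prop :=
  ∀ f : Tor L → ℝ, 3 ≤ L →
    (∑ k : Tor L, jK L Δ f k ^ 3) / (L : ℝ) ^ 2 = PJU L Δ f ∧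
    (∑ k : Tor L, jK L Δ f k ^ 2 * Real.cos (2 * Real.pi * k.1.val / L)) / (L : ℝ) ^ 2 = AJU L Δ f ∧
    6 * (∑ k : Tor L, jK L Δ f k ^ 2 * jK L Δ f (k + K1 L)) / (L : ℝ) ^ 2 = BJU L Δ f ∧
    (∑ k : Tor L, jK L Δ f k) / (L : ℝ) ^ 2 = bPar L Δ f ^ 2 - aPar L Δ f ^ 2 ∧
    (∑ k : Tor L, jK L Δ f k * Real.cos (2 * Real.pi * k.1.val / L)) / (L : ℝ) ^ 2 = bPar L Δ f ^ 2 ∧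
    bPar L Δ f ^ 2 - aPar L Δ f ^ 2 = sigPar L Δ f * (aPar L Δ f + bPar L Δ f) ∧
    BJU L Δ f + 6 * aPar L Δ f ^ 2 * AJU L Δ f = 6 * aPar L Δ f ^ 4 * sigPar L Δ f * (aPar L Δ f + bPar L Δ f)

/-! ## §3 The reduced one-loop objects, graded by the number of reduced slots (`X = X_JU + λ₂·XSr`) -/

/-- `PSr := (1/V)Σ_k [3j²·FSr + λ₂·3j·FSr² + λ₂²·FSr³]`. -/
def PSr (Δ lam2 : ℝ) (f : Tor L → ℝ) : ℝ :=
  (∑ k : Tor L, (3 * jK L Δ f k ^ 2 * FSr L Δ lam2 f k + lam2 * (3 * jK L Δ f k * FSr L Δ lam2 f k ^ 2)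
      + lam2 ^ 2 * FSr L Δ lam2 f k ^ 3)) / (L : ℝ) ^ 2

/-- `ASr := (1/V)Σ_k [2j·FSr + λ₂·FSr²] cos kₓ`. -/
def ASr (Δ lam2 : ℝ) (f : Tor L → ℝ) : ℝ :=
  (∑ k : Tor L, (2 * jK L Δ f k * FSr L Δ lam2 f k + lam2 * FSr L Δ lam2 f k ^ 2)
      * Real.cos (2 * Real.pi * k.1.val / L)) / (L : ℝ) ^ 2

/-- `BSr := (6/V)Σ_k [2j j′ FSr + j² FSr′ + λ₂(FSr² j′ + 2 j FSr FSr′) + λ₂² FSr² FSr′]`, `′ = (· + K₁)`. -/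
def BSr (Δ lam2 : ℝ) (f : Tor L → ℝ) : ℝ :=
  6 * (∑ k : Tor L,
      (2 * jK L Δ f k * jK L Δ f (k + K1 L) * FSr L Δ lam2 f k + jK L Δ f k ^ 2 * FSr L Δ lam2 f (k + K1 L)
        + lam2 * (FSr L Δ lam2 f k ^ 2 * jK L Δ f (k + K1 L)
                    + 2 * jK L Δ f k * FSr L Δ lam2 f k * FSr L Δ lam2 f (k + K1 L))
        + lam2 ^ 2 * (FSr L Δ lam2 f k ^ 2 * FSr L Δ lam2 f (k + K1 L)))) / (L : ℝ) ^ 2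

/-- `QSr := −(3/2)Σ_e (1/V)Σ_k [2a²Re(z̄ φSr)·j + a⁴·FSr + λ₂(|φSr|² j + 2a²Re(z̄ φSr) FSr) + λ₂²|φSr|² FSr]`
(`Re(z̄ φSr) = Re(conj(a⁻²·a²z)·φSr)`; `|a²z|² = a⁴`). -/
def QSr (Δ lam2 : ℝ) (f : Tor L → ℝ) : ℝ :=
  -(3 / 2) * ((nnList L).map (fun e =>
      (∑ k : Tor L,
        (2 * aPar L Δ f ^ 2 * ((starRingEnd ℂ) (zPh L k e) * phiSr L Δ lam2 f e k).re * jK L Δ f k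
          + aPar L Δ f ^ 4 * FSr L Δ lam2 f k
          + lam2 * (Complex.normSq (phiSr L Δ lam2 f e k) * jK L Δ f k
                      + 2 * aPar L Δ f ^ 2 * ((starRingEnd ℂ) (zPh L k e) * phiSr L Δ lam2 f e k).re * FSr L Δ lam2 f k)
          + lam2 ^ 2 * (Complex.normSq (phiSr L Δ lam2 f e k) * FSr L Δ lam2 f k))) / (L : ℝ) ^ 2)).sum

/-- degree-1 part of the `B_C` integrand under `φ = a²z + λ₂φSr`, `F = j + λ₂FSr` (`′ = (· + K₁)`; `r₀₀ := a⁴Re(z̄ z′)`,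
`r₀₁ := a²Re(z̄ φSr′ + conj(φSr) z′)`, `n₀₀ := a⁴`, `n₀₁ := 2a²Re(z̄ φSr)`): `r₀₀(FSr + FSr′) + r₀₁(j + j′) + n₀₀FSr′ + n₀₁ j′`. -/
def bcDeg1 (Δ lam2 : ℝ) (f : Tor L → ℝ) (e k : Tor L) : ℝ :=
  aPar L Δ f ^ 4 * ((starRingEnd ℂ) (zPh L k e) * zPh L (k + K1 L) e).re
      * (FSr L Δ lam2 f k + FSr L Δ lam2 f (k + K1 L))
    + aPar L Δ f ^ 2 * ((starRingEnd ℂ) (zPh L k e) * phiSr L Δ lam2 f e (k + K1 L)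
                          + (starRingEnd ℂ) (phiSr L Δ lam2 f e k) * zPh L (k + K1 L) e).re
      * (jK L Δ f k + jK L Δ f (k + K1 L))
    + aPar L Δ f ^ 4 * FSr L Δ lam2 f (k + K1 L)
    + 2 * aPar L Δ f ^ 2 * ((starRingEnd ℂ) (zPh L k e) * phiSr L Δ lam2 f e k).re * jK L Δ f (k + K1 L)

/-- degree-2 part (`r₁₁ := Re(conj(φSr) φSr′)`, `n₁₁ := |φSr|²`): `r₀₁(FSr + FSr′) + r₁₁(j + j′) + n₀₁FSr′ + n₁₁ j′`. -/
def bcDeg2 (Δ lam2 : ℝ) (f : Tor L → ℝ) (e k : Tor L) : ℝ :=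
  aPar L Δ f ^ 2 * ((starRingEnd ℂ) (zPh L k e) * phiSr L Δ lam2 f e (k + K1 L)
                        + (starRingEnd ℂ) (phiSr L Δ lam2 f e k) * zPh L (k + K1 L) e).re
      * (FSr L Δ lam2 f k + FSr L Δ lam2 f (k + K1 L))
    + ((starRingEnd ℂ) (phiSr L Δ lam2 f e k) * phiSr L Δ lam2 f e (k + K1 L)).re * (jK L Δ f k + jK L Δ f (k + K1 L))
    + 2 * aPar L Δ f ^ 2 * ((starRingEnd ℂ) (zPh L k e) * phiSr L Δ lam2 f e k).re * FSr L Δ lam2 f (k + K1 L)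
    + Complex.normSq (phiSr L Δ lam2 f e k) * jK L Δ f (k + K1 L)

/-- degree-3 part: `r₁₁(FSr + FSr′) + n₁₁FSr′`. -/
def bcDeg3 (Δ lam2 : ℝ) (f : Tor L → ℝ) (e k : Tor L) : ℝ :=
  ((starRingEnd ℂ) (phiSr L Δ lam2 f e k) * phiSr L Δ lam2 f e (k + K1 L)).re
      * (FSr L Δ lam2 f k + FSr L Δ lam2 f (k + K1 L))
    + Complex.normSq (phiSr L Δ lam2 f e k) * FSr L Δ lam2 f (k + K1 L)

/-- `BCSr := −3Σ_e (1/V)Σ_k [deg-1 + λ₂·deg-2 + λ₂²·deg-3]` — the reduced part of `B_C = −3Σ_e(1/V)Σ_k[Re(conj φ φ′)(F + F′)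
+ |φ|²F′]` under `φ = a²z + λ₂φSr`, `F = j + λ₂FSr` (the degree-0 part is `λ₂·BCJUr`, `BCNuSplit`). -/
def BCSr (Δ lam2 : ℝ) (f : Tor L → ℝ) : ℝ :=
  -3 * ((nnList L).map (fun e =>
      (∑ k : Tor L, (bcDeg1 L Δ lam2 f e k + lam2 * bcDeg2 L Δ lam2 f e k + lam2 ^ 2 * bcDeg3 L Δ lam2 f e k))
        / (L : ℝ) ^ 2)).sum

/-- ★ (S) THE FIVE OBJECTS, FACTORED: `P = P_JU + λ₂PSr`, `A = A_JU + λ₂ASr`, `B = B_JU + λ₂BSr`, `Q = λ₂(QJUr + QSr)`,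
`B_C = λ₂(BCJUr + BCSr)` (one-loop forms `PiNormOneLoop` … `BCOneLoop` + (F) + (Φ) + `JUClosedSums` + `DictionaryNu`; exact algebra). -/
def ObjectsNuSplit (Δ : ℝ) : Prop :=
  ∀ lam2 : ℝ, ∀ f : Tor L → ℝ, 5 ≤ L → 0 ≤ Δ → Δ < 1 → IsGroundTwoMagnon L Δ lam2 f →
    PiNormSq L f = PJU L Δ f + lam2 * PSr L Δ lam2 f ∧
    Axhat L f = AJU L Δ f + lam2 * ASr L Δ lam2 f ∧
    Bterm L f = BJU L Δ f + lam2 * BSr L Δ lam2 f ∧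
    (∑ c : Cfg L, piR L f c * C0fn L Δ lam2 f c) = lam2 * (QJUr L Δ lam2 f + QSr L Δ lam2 f) ∧
    BCterm L Δ lam2 f = lam2 * (BCJUr L Δ lam2 f + BCSr L Δ lam2 f)

/-! ## §4 ★ `N1RowJUFactor`: `N₁ = λ₂·N1red`, `U = λ₂·Ured` -/

/-- `Ured := 3V²·(3 + (QJUr + QSr)/P)` (`U = 3V²T⁺`, `T⁺ = 3λ₂ + Q/P`). -/
def Ured (Δ lam2 : ℝ) (f : Tor L → ℝ) : ℝ :=
  3 * ((L : ℝ) ^ 2) ^ 2 * (3 + (QJUr L Δ lam2 f + QSr L Δ lam2 f) / PiNormSq L f)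

/-- the LINEARISED jump part `N1JUlin := −ε₁(B_JU + 6a²A_JU)/λ₂ = −6ε₁a⁴(a + b)(V + a)G̃(0)` (`JUClosedSums` σ-factor +
`σ = λ₂(V+a)G̃(0)`; the two `≈ ±23·U` pieces `−ε₁B_JU`, `−6ε₁a²A_JU` have cancelled HERE, symbolically). -/
def N1JUlin (Δ lam2 : ℝ) (f : Tor L → ℝ) : ℝ :=
  -6 * eps1 L * aPar L Δ f ^ 4 * (aPar L Δ f + bPar L Δ f) * (((L : ℝ) ^ 2 + aPar L Δ f) * Gres L lam2 0)

/-- `N1red := N1JUlin − ε₁(BSr + 6a²ASr) − (3/2)ε₁·a·V·A − (QJUr + QSr)·(B/P + ε₁/2) − (3/2)ε₁·P + BCJUr + BCSr`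
(from `N₁ = −ε₁(B + 6Δf_nn²A) − (Q/P)(B + ε₁P/2) − (3/2)ε₁λ₂P + B_C` — `N1Identity` + `G2OneLoopForm` + `sum_piR_C0fn` —
with `Δf_nn² = a² + λ₂aV/4`, `Q = λ₂(QJUr + QSr)`, `B_C = λ₂(BCJUr + BCSr)`, (S), (JU); NO division by a jump quantity, every
summand `O(1)·Ured` or smaller: measured (units of `Ured`, L = 9…128, ν ≤ .01; check_partN41F_v2.out) `N1JUlin ∈ [−1.7e-3, 0)`,
`−(QJUr+QSr)(B/P + ε₁/2) ∈ [−4e-5, +4e-5]`, `BCJUr ∈ [−.039, −3.9e-4]` (`≈ −8G̃(0)/V`), `−ε₁BSr ∈ [+.667, +.688]`,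
`−(3/2)ε₁aV·A` and `−(3/2)ε₁P` each `∈ [−.040, −2e-4]`, `BCSr ∈ [+4e-4, +.039]`, all `λ₂`-suppressed classes `≤ .012·(ν/.01)`). -/
def N1red (Δ lam2 : ℝ) (f : Tor L → ℝ) : ℝ :=
  N1JUlin L Δ lam2 f - eps1 L * (BSr L Δ lam2 f + 6 * aPar L Δ f ^ 2 * ASr L Δ lam2 f)
    - 3 / 2 * eps1 L * aPar L Δ f * (L : ℝ) ^ 2 * Axhat L f
    - (QJUr L Δ lam2 f + QSr L Δ lam2 f) * (Bterm L f / PiNormSq L f + eps1 L / 2)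
    - 3 / 2 * eps1 L * PiNormSq L f + BCJUr L Δ lam2 f + BCSr L Δ lam2 f

/-- ★★ `N1RowJUFactor` (lead R3(i) / p2 g5 / p3 2(c)): for the ground profile, `L ≥ 5`, `0 ≤ Δ < 1` (so `λ₂ > 0`, `lam2_pos`):
`T⁺ = λ₂(3 + (QJUr + QSr)/P)`, `U = λ₂·Ured`, `N₁ = λ₂·N1red`.  The `ν = 0` parts have cancelled IDENTICALLY (they are the
closed polynomials times `σ = λ₂(V+a)G̃(0)`), and `c₁ = N₁/U = N1red/Ured`. -/
def N1RowJUFactor (Δ : ℝ) : Prop :=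
  ∀ lam2 : ℝ, ∀ f : Tor L → ℝ, 5 ≤ L → 0 ≤ Δ → Δ < 1 → IsGroundTwoMagnon L Δ lam2 f →
    Tplus L Δ f = lam2 * (3 + (QJUr L Δ lam2 f + QSr L Δ lam2 f) / PiNormSq L f) ∧
    Uunit L Δ f = lam2 * Ured L Δ lam2 f ∧
    trialGapN1 L Δ f = lam2 * N1red L Δ lam2 f

/-- ★ COROLLARY (what the corner certificates target): a reduced inequality `c·Ured ≤ N1red` on the ground profiles gives
`TrialGapAbs L Δ c` (`λ₂ > 0` cancels).  The per-`L` certificates close `Δ ∈ (Δ₁, 1)` with it; the `∀ L ≥ 128` certificate closes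
the strip corner / R3 with it. -/
def TrialGapFromReduced (Δ c : ℝ) : Prop :=
  5 ≤ L → 0 ≤ Δ → Δ < 1 →
    (∀ lam2 : ℝ, ∀ f : Tor L → ℝ, IsGroundTwoMagnon L Δ lam2 f → c * Ured L Δ lam2 f ≤ N1red L Δ lam2 f) →
      TrialGapAbs L Δ c

/-- ★ THE REDUCED ROW FROM BRACKETS (the evaluator's contract; same shape as `N1FromPieces`; PROVED below, `n1RedFromPieces_holds`):
a lower bound of `N1red` from brackets on its summands — `Jlo ≤ N1JUlin` (from `G̃(0) ≤ gL⁺`, `a ≥ 0`), `BSr ≤ BShi`, `ASr ≤ AShi`,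
`Axhat ≤ Ahi`, `Mlo ≤ −(QJUr + QSr)(B/P + ε₁/2)` (corner product of the two brackets), `PiNormSq ≤ Phi`, `Clo ≤ BCJUr + BCSr`;
and `Ured` from above by `Ured ≤ 3V²(3 + max-corner((QJUr⁺ + QSr⁺)/P))`. -/
def N1RedFromPieces (Δ : ℝ) : Prop :=
  ∀ lam2 : ℝ, ∀ f : Tor L → ℝ, 5 ≤ L → 0 ≤ Δ → Δ < 1 → IsGroundTwoMagnon L Δ lam2 f →
    ∀ Jlo BShi AShi Ahi Mlo Phi Clo : ℝ,
      Jlo ≤ N1JUlin L Δ lam2 f → BSr L Δ lam2 f ≤ BShi → ASr L Δ lam2 f ≤ AShi → 0 ≤ aPar L Δ f →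
      Axhat L f ≤ Ahi →
      Mlo ≤ -((QJUr L Δ lam2 f + QSr L Δ lam2 f) * (Bterm L f / PiNormSq L f + eps1 L / 2)) →
      PiNormSq L f ≤ Phi → Clo ≤ BCJUr L Δ lam2 f + BCSr L Δ lam2 f →
        Jlo - eps1 L * (BShi + 6 * aPar L Δ f ^ 2 * AShi) - 3 / 2 * eps1 L * aPar L Δ f * (L : ℝ) ^ 2 * Ahi + Mlo
            - 3 / 2 * eps1 L * Phi + Clo
          ≤ N1red L Δ lam2 f

/-! ## §5 The corner value (record)

`N1RedCorner`: as `ν → 0⁺` at fixed `L` every `λ₂`-weighted class of §3 vanishes and `FSr → −2b(V+a)g`, `φSr → (aV/4)(1+z)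
− b(V+a)(1−z)g` (`k ≠ 0`), `a → V/(V−1)`, `b → a`: `N1red`, `Ured` converge to EXPLICIT one-propagator sums (`Σ_k g`, `Σ_k g cos kₓ`,
`Σ_k g(k)g(k+K₁)`-free!) and `c₁(L, 0⁺) = N1red₀/Ured₀` is a closed trigonometric sum per `L`: `.6039 (9), .6308 (12), .6464 (16),
.6577 (24), .6614 (32), .6643 (48), .6655 (64), → 2/3`.  Its leading term is the single momentum `k = K₁` of `B⁽¹⁾`:
`−ε₁(6/V)j(0)²FSr(K₁)/Ured = 12ε₁g(K₁)·b(V+a)j(0)²/(V·Ured) + O(λ₂) → (4/3)·ε₁/(2ε₁ − λ₂) → 2/3`.  (Typed as a remark only; the certificates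
need §4, not the limit.) -/

/-! ## PORT NOTES (p1 lead g29+ / p2 g6+ / p3 successor)

* STATUS: every Prop of this file is PROVED in §6 (`dictionaryNu_holds`, `tailsViaGreen_holds`, `f2NuSplit_holds`,
  `phiHatNuSplit_holds`, `juClosedSums_holds`, `fsrClosures_holds`, `objectsNuSplit_holds` (= `_PAB`, `_Q`, `_BC`),
  `n1RowJUFactor_holds`, `trialGapFromReduced_holds`, `n1RedFromPieces_holds`); the port is a COPY under the tree prefix
  (suggested module `…Fibre3N1RowJUFactor`, namespace `N41F` or flattened), imports as in this file.  Proof anatomy, for the record: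
  `DictionaryNu` (one-liner from `ManifoldA.manifold_dictionary`), `TailsViaGreen` (from `ground_profile_aKer`,
  `cS_mul_Gres_zero`, `dft` linearity; the `r = 0` case is `sfun'` by definition), `F2NuSplit`/`PhiHatNuSplit` (rewrite
  `F2ClosedPlusTail`/`PhiHatClosedPlusTail`, landed as `…F2Decomp`/`…PhiHatClosed`, with the two previous items; `k = 0` uses
  `nf2V`, `gamPar`), `JUClosedSums` (finite trigonometric sums: `Σ_k cos kₓ = 0` is `B1`/`FamilyA` material; the last two items
  are `field_simp; ring`), `ObjectsNuSplit` (expand `(j + λ₂FSr)³` etc. under `Finset.sum`; pure algebra, the gradings of §3 are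
  verified numerically to 1e-16), `N1RowJUFactor` (substitute into `N1Identity` + `G2OneLoopForm` + `sum_piR_C0fn`; `Tplus = 3λ₂
  + Q/P` is `TplusFromPC0`'s identity), `TrialGapFromReduced` (`lam2_pos`, `mul_le_mul_left`), `N1RedFromPieces` (monotonicity,
  as `n1_ge_pieces`).
* EVALUATOR (p2 RExpr / p3 per-L): (i) never form `B`, `A·Δf²`, `Q`, `B_C` as wholes at `ν ≲ .01`; form `BSr, ASr, QSr, BCSr`
  (the SAME named one- and two-propagator sums as now, with the slot `F₂` replaced by `FSr = −2b(V+a)g + λ₂(V+a)²T₂` and `φ̂` by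
  `a²z + λ₂φSr`; the brackets `TtailBounds`/`TauTailBound` become `0 ≤ T₂(k) ≤ 2G̃(0)/(ε(k) − 2λ₂)`-type and `|T_e(k)| ≤ T_e(0)
  = ‖D_eG̃‖² = τ̄/c_s²` with `τ̄ = tauBar` closed); (ii) `σ = λ₂(V+a)G̃(0)` is ALREADY substituted in `N1JUlin`, `QJUr`, `BCJUr` (never
  re-form `1 − a + a/V` from the `a`-interval: that re-introduces the width); (iii) certify `c·Ured ≤ N1red` by `N1RedFromPieces`;
  the loss is now `O(w)` uniformly in `ν`.  (iv) `G̃(0)` appears only in `N1JUlin`, `QJUr`, `BCJUr`, all `× a⁴(a+b)(V+a)/(…V²)`: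
  per `L` it is a bracketed number (`GzeroNamed`); for `∀ L ≥ 128` use `G̃(0) ≤ ln L/2π + .051 + .234ν` (`capacity_KT_bounds`) and
  `ln L/L² ≤ ln 128/128²`: `|N1JUlin + BCJUr| ≤ 4.1e-4·Ured`, `|3V²QJUr/P| ≤ 2.1e-4·Ured` — constants.
* WHAT IS NOT CLAIMED: the large-`a` side `a > 1` (allowed: `a → V/(V−1)`) needs no separate treatment — every statement above is
  an identity in `a`; the brackets of (i) need `2λ₂ < ε₁`-type hypotheses exactly as `TtailBounds` does (automatic on the corner).
* The interim side condition `Δ ≤ Δ₁ = 0.98` of the per-`L` and `L`-free certificates (lead R3) is lifted by porting §4 and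
  re-running the SAME evaluators on the reduced row for `Δ ∈ [Δ₁, 1)`: expected certified `c₁ ≥ .55` at every `L ≥ 9` with ONE
  ν-cell `(0, ν(Δ₁)]` per `L` (true value .600–.666, evaluator loss `O(w) ≈ .02–.05`), vs the c of record ≤ .51.
-/


end N41F

end Summit.HubbardSuperconductivity.HubbardSuperconductivity.Theorems.AnisotropyChord.Transfer.Fibre3

end
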